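import Mathlib.NumberTheory.NumberField.Units.DirichletTheorem
import Literature.Algebra.EuclideanLattices.LatticeBoxPointCounting
import HarnessLib

/-!
# Units of a number field in a box: `#{u ∈ 𝓞_Kˣ : w(xu) ≤ T ∀ w} ≪_K (1 + log T)^{rk 𝓞_Kˣ}`

Topic `NumberTheory/NumberFields`, namespace `Literature.NumberTheory.NumberFields`. Everything in
this file is PROVED (theorems only; no definitions, no named facts).

For a number field `K` of degree `d`, a nonzero `x ∈ 𝓞_K` and `T ≥ 1`, the number of units `u`
with `w(xu) ≤ T` at every infinite place `w` — equivalently, the number of generators of the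
principal ideal `(x)` lying in the box `{y : |σ(y)| ≤ T ∀ σ}` — is `≤ C_K (1 + log T)^r`,
`r = r₁ + r₂ − 1` the unit rank, with `C_K` depending only on `K` (not on `x`). This is the
standard consequence of Dirichlet's unit theorem that is used whenever elements of `𝓞_K` are
counted through the ideals they generate; e.g. in the Maynard–Tao sieve over `𝓞_K`
(Castillo–Hall–Lemke Oliver–Pollack–Thompson, Proc. AMS 143 (2015), proof of Lemma 2.3) a prime
`α + h_m` in a box generating a *fixed* prime ideal has to be counted, and this count is what makes
that contribution negligible. Proof: normalise `x` into the box (replace it by `x u₀`); then every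
`a_w := mult(w)(log T − log w(x)) ≥ 0` and `∑_w a_w = d log T − log |N(x)| ≤ d log T`, so for a unit
`u` with `xu` in the box the vector `(mult(w) log w(u))_w` (coordinates summing to `0`, each
`≤ a_w`) lies in the cube `[−d log T, d log T]^{r+1}`; under Mathlib's logarithmic embedding
(`NumberField.Units.logEmbedding`, kernel = roots of unity, image = the full lattice
`NumberField.Units.unitLattice` of Dirichlet's theorem) the units in question therefore land in a
cube of side `2d log T`, where a fixed full lattice has `≪ L^r` points in a cube of side `L ≥ 1`
(`Literature.Algebra.EuclideanLattices.abs_card_inter_coordBox_sub_le`).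
[cite: Marcus2018, Ch. 5, Theorem 38 and its proof (the logarithmic embedding; units of bounded
size are finitely many modulo nothing but roots of unity), Ch. 6, Lemma 2 (lattice points)];
[folklore].

* `abs_mult_mul_log_le` — the cube: `|mult(w) log w(u)| ≤ d log T` at every place `w`;
* `exists_finset_box_inter_unitLattice` — points of the unit lattice in the cube `[−M, M]^r` are
  `≤ C (1 + M)^r`;
* `finite_units_mul_mem_box`, **`card_units_mul_mem_box_le`** — finiteness, and the bound
  `∃ C ≥ 1, ∀ x ≠ 0, ∀ T ≥ 1`, every finite set of units `u` with `w(xu) ≤ T ∀ w` has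
  `≤ C (1 + log T)^{rank K}` elements (`ncard_units_mul_mem_box_le`: the same for `Set.ncard`);
* **`card_generators_mem_box_le`** — the same bound for `#{y : (y) = I, w(y) ≤ T ∀ w}`, any
  ideal `I` of `𝓞_K`.

## Mathlib search

`NumberField.Units.logEmbedding`, `logEmbedding_component`, `logEmbedding_eq_zero_iff`,
`NumberField.Units.unitLattice`, `unitLattice_inter_ball_finite`, `basisUnitLattice`,
`Module.Basis.ofZLatticeBasis(_span)`, `NumberField.Units.sum_mult_mul_log`,
`NumberField.InfinitePlace.prod_eq_abs_norm`, `sum_mult_eq`, `NumberField.Embeddings.finite_of_norm_le`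
(`lean search 'card.*torsion.*log|units.*box|logEmbedding.*card'`: no quantitative unit count in
Mathlib or the tree).
-/

noncomputable section

open NumberField NumberField.InfinitePlace NumberField.Units NumberField.Units.dirichletUnitTheorem
open Module Submodule Set

namespace Literature.NumberTheory.NumberFields

variable (K : Type*) [Field K] [NumberField K]

/-- **The cube.** If `x ∈ 𝓞_K` is nonzero with `w(x) ≤ T` for all infinite places `w`
and `u` is a unit with `w(xu) ≤ T` for all `w`, then `|mult(w) · log w(u)| ≤ d · log T` for every
`w`, `d = [K : ℚ]`: the numbers `a_w = mult(w)(log T − log w(x))` are `≥ 0` with sum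
`d log T − log|N(x)| ≤ d log T`, and `y_w = mult(w) log w(u) ≤ a_w` has `∑_w y_w = 0`.
[cite: Marcus2018, Ch. 5, proof of Theorem 38]; [folklore] -/
theorem abs_mult_mul_log_le {x : 𝓞 K} (hx : x ≠ 0) {T : ℝ}
    (hxT : ∀ w : InfinitePlace K, w (x : K) ≤ T) {u : (𝓞 K)ˣ}
    (hu : ∀ w : InfinitePlace K, w ((x : K) * u) ≤ T) (w : InfinitePlace K) :
    |(w.mult : ℝ) * Real.log (w u)| ≤ Module.finrank ℚ K * Real.log T := by
  classical
  have hx' : (x : K) ≠ 0 := RingOfIntegers.coe_ne_zero_iff.mpr hx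
  have hxpos : ∀ w : InfinitePlace K, 0 < w (x : K) := fun w => pos_iff.mpr hx'
  set a : InfinitePlace K → ℝ := fun w => w.mult * (Real.log T - Real.log (w (x : K))) with ha
  set y : InfinitePlace K → ℝ := fun w => w.mult * Real.log (w u) with hy
  have ha0 : ∀ w, 0 ≤ a w := fun w =>
    mul_nonneg (Nat.cast_nonneg _) (sub_nonneg.2 (Real.log_le_log (hxpos w) (hxT w)))
  have hya : ∀ w, y w ≤ a w := fun w => by
    have h1 : Real.log (w ((x : K) * u)) ≤ Real.log T :=
      Real.log_le_log (by rw [map_mul]; exact mul_pos (hxpos w) (Units.pos_at_place u w)) (hu w)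
    rw [map_mul, Real.log_mul (hxpos w).ne' (Units.pos_at_place u w).ne'] at h1
    simp only [ha, hy]
    exact mul_le_mul_of_nonneg_left (by linarith) (Nat.cast_nonneg _)
  have hsum_a : ∑ w, a w ≤ Module.finrank ℚ K * Real.log T := by
    have h1 : ∑ w : InfinitePlace K, (w.mult : ℝ) * Real.log (w (x : K)) =
        Real.log ((|Algebra.norm ℚ (x : K)| : ℚ) : ℝ) := by
      rw [← prod_eq_abs_norm, Real.log_prod]
      · exact Finset.sum_congr rfl fun w _ => by rw [Real.log_pow]
      · intro w _
        exact pow_ne_zero _ (hxpos w).ne'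
    have h2 : 0 ≤ Real.log ((|Algebra.norm ℚ (x : K)| : ℚ) : ℝ) := by
      apply Real.log_nonneg
      have h : (1 : ℚ) ≤ |Algebra.norm ℚ (x : K)| := by
        rw [← Algebra.coe_norm_int, ← Int.cast_one, ← Int.cast_abs, Int.cast_le]
        exact Int.one_le_abs (Algebra.norm_ne_zero_iff.mpr hx)
      exact_mod_cast h
    have h3 : ∑ w, a w = (∑ w : InfinitePlace K, (w.mult : ℝ)) * Real.log T -
        ∑ w : InfinitePlace K, (w.mult : ℝ) * Real.log (w (x : K)) := by
      simp only [ha, mul_sub, Finset.sum_sub_distrib, Finset.sum_mul]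
    have h4 : ∑ w : InfinitePlace K, (w.mult : ℝ) = Module.finrank ℚ K := by
      rw [← sum_mult_eq (K := K)]
      push_cast
      rfl
    rw [h3, h4, h1]
    linarith
  have hsum_y : ∑ w, y w = 0 := Units.sum_mult_mul_log u
  rw [abs_le]
  constructor
  · have h1 : y w + ∑ w' ∈ Finset.univ.erase w, y w' = 0 := by
      rw [Finset.add_sum_erase _ _ (Finset.mem_univ w)]
      exact hsum_y
    have h2 : ∑ w' ∈ Finset.univ.erase w, y w' ≤ ∑ w' ∈ Finset.univ.erase w, a w' :=
      Finset.sum_le_sum fun w' _ => hya w'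
    have h3 : ∑ w' ∈ Finset.univ.erase w, a w' ≤ ∑ w', a w' :=
      Finset.sum_le_sum_of_subset_of_nonneg (Finset.erase_subset _ _) fun w' _ _ => ha0 w'
    show -(↑(Module.finrank ℚ K) * Real.log T) ≤ y w
    linarith
  · show y w ≤ _
    calc y w ≤ a w := hya w
      _ ≤ ∑ w', a w' := Finset.single_le_sum (fun w' _ => ha0 w') (Finset.mem_univ w)
      _ ≤ _ := hsum_a

/-- **Lattice points of the unit lattice in a cube.** There is `C = C(K) ≥ 1` such that for every
`M ≥ 0` the points of `unitLattice K` in the cube `[−M, M]^{r}` of the log-space form a finite set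
with at most `C (1 + M)^r` elements, `r = rank K`. (The unit lattice is a full lattice —
Dirichlet's theorem, Mathlib's `instZLattice_unitLattice` — and a full lattice meets a cube of
side `L ≥ 1` in `≤ L^r/covol + O(L^{r−1})` points.)
[cite: Marcus2018, Ch. 6, Lemma 2 (proof, pp. 126–127)] -/
theorem exists_finset_box_inter_unitLattice :
    ∃ C : ℝ, 1 ≤ C ∧ ∀ M : ℝ, 0 ≤ M → ∃ F : Finset (logSpace K),
      (∀ v, v ∈ F ↔ v ∈ (Set.univ.pi fun _ => Icc (-M) M) ∧ v ∈ unitLattice K) ∧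
      (F.card : ℝ) ≤ C * (1 + M) ^ rank K := by
  classical
  -- finiteness: the cube lies in the closed ball of radius `M`
  have hfin : ∀ M : ℝ, 0 ≤ M → ((Set.univ.pi fun _ : {w : InfinitePlace K // w ≠ w₀} =>
      Icc (-M) M) ∩ (unitLattice K : Set (logSpace K))).Finite := fun M hM => by
    refine (unitLattice_inter_ball_finite K M).subset ?_
    rintro v ⟨hv₁, hv₂⟩
    refine ⟨hv₂, mem_closedBall_zero_iff.2 ((pi_norm_le_iff_of_nonneg hM).2 fun i => ?_)⟩
    rw [Real.norm_eq_abs, abs_le]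
    exact Set.mem_univ_pi.1 hv₁ i
  have hpow1 : ∀ M : ℝ, 0 ≤ M → (1 : ℝ) ≤ (1 + M) ^ rank K := fun M hM =>
    one_le_pow₀ (by linarith)
  rcases isEmpty_or_nonempty {w : InfinitePlace K // w ≠ w₀} with hκ | hκ
  · -- rank 0: the log-space is a point
    refine ⟨1, le_rfl, fun M hM => ⟨(hfin M hM).toFinset, fun v => ?_, ?_⟩⟩
    · rw [Set.Finite.mem_toFinset]
      rfl
    · have hsub : Subsingleton (logSpace K) := inferInstance
      have h : ((hfin M hM).toFinset.card : ℝ) ≤ 1 := by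
        exact_mod_cast Finset.card_le_one.2 fun a _ b _ => Subsingleton.elim a b
      calc ((hfin M hM).toFinset.card : ℝ) ≤ 1 := h
        _ ≤ 1 * (1 + M) ^ rank K := by rw [one_mul]; exact hpow1 M hM
  · -- rank ≥ 1: the uniform box count for the full lattice `unitLattice K`
    set b : Basis (Fin (rank K)) ℝ (logSpace K) :=
      (basisUnitLattice K).ofZLatticeBasis ℝ (unitLattice K) with hb
    have hspan : span ℤ (Set.range b) = unitLattice K :=
      (basisUnitLattice K).ofZLatticeBasis_span ℝ (unitLattice K)
    have hcardκ : Fintype.card {w : InfinitePlace K // w ≠ w₀} = rank K := by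
      rw [Fintype.card_subtype_compl, Fintype.card_subtype_eq]
      rfl
    obtain ⟨C₀, hC₀⟩ :=
      Literature.Algebra.EuclideanLattices.abs_card_inter_coordBox_sub_le
        (κ := {w : InfinitePlace K // w ≠ w₀}) b
    set cov : ℝ := MeasureTheory.volume.real (ZSpan.fundamentalDomain b) with hcov
    have hcov0 : 0 ≤ cov := MeasureTheory.measureReal_nonneg
    refine ⟨max 1 ((1 / cov + |C₀|) * 2 ^ rank K), le_max_left _ _, fun M hM =>
      ⟨(hfin M hM).toFinset, fun v => ?_, ?_⟩⟩
    · rw [Set.Finite.mem_toFinset]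
      rfl
    set L : ℝ := max 1 (2 * M) with hL
    have hL1 : 1 ≤ L := le_max_left _ _
    have hL2 : 2 * M ≤ L := le_max_right _ _
    have hL3 : L ≤ 2 * (1 + M) := max_le (by linarith) (by linarith)
    have h := hC₀ (fun _ => -M) (fun _ => M) L hL1 (fun _ => by linarith) (fun _ => by linarith)
      (Set.univ.pi fun _ => Icc (-M) M) (Set.pi_mono fun _ _ => Ioo_subset_Icc_self) subset_rfl
    rw [hspan, hcardκ] at h
    have hnat : (Nat.card ↥((Set.univ.pi fun _ : {w : InfinitePlace K // w ≠ w₀} => Icc (-M) M) ∩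
        (unitLattice K : Set (logSpace K))) : ℝ) = (hfin M hM).toFinset.card := by
      rw [Nat.card_coe_set_eq, Set.ncard_eq_toFinset_card _ (hfin M hM)]
    rw [hnat] at h
    have hprod : ∏ _j : {w : InfinitePlace K // w ≠ w₀}, (M - -M) = (2 * M) ^ rank K := by
      rw [Finset.prod_const, Finset.card_univ, hcardκ]
      ring
    rw [hprod] at h
    have h1 : ((hfin M hM).toFinset.card : ℝ) ≤ (2 * M) ^ rank K / cov + C₀ * L ^ (rank K - 1) := by
      have := (abs_le.1 h).2
      linarith
    have h2 : (2 * M) ^ rank K / cov ≤ L ^ rank K / cov :=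
      div_le_div_of_nonneg_right (pow_le_pow_left₀ (by linarith) hL2 _) hcov0
    have h3 : C₀ * L ^ (rank K - 1) ≤ |C₀| * L ^ rank K := by
      calc C₀ * L ^ (rank K - 1) ≤ |C₀| * L ^ (rank K - 1) :=
            mul_le_mul_of_nonneg_right (le_abs_self _) (by positivity)
        _ ≤ |C₀| * L ^ rank K :=
            mul_le_mul_of_nonneg_left (pow_le_pow_right₀ hL1 (Nat.sub_le _ _)) (abs_nonneg _)
    have h4 : L ^ rank K ≤ 2 ^ rank K * (1 + M) ^ rank K := by
      rw [← mul_pow]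
      exact pow_le_pow_left₀ (by linarith) hL3 _
    have h5 : 0 ≤ 1 / cov + |C₀| := by positivity
    calc ((hfin M hM).toFinset.card : ℝ) ≤ L ^ rank K / cov + |C₀| * L ^ rank K := by linarith
      _ = (1 / cov + |C₀|) * L ^ rank K := by ring
      _ ≤ (1 / cov + |C₀|) * (2 ^ rank K * (1 + M) ^ rank K) :=
          mul_le_mul_of_nonneg_left h4 h5
      _ = ((1 / cov + |C₀|) * 2 ^ rank K) * (1 + M) ^ rank K := by ring
      _ ≤ max 1 ((1 / cov + |C₀|) * 2 ^ rank K) * (1 + M) ^ rank K :=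
          mul_le_mul_of_nonneg_right (le_max_right _ _) (by positivity)

/-- **Finiteness.** For `x ∈ 𝓞_K` nonzero, the units `u` with `w(xu) ≤ T` for all infinite places
`w` are finitely many: `w(u) ≤ T/w(x)`, so all conjugates of `u` are bounded, and integral elements
with bounded conjugates are finitely many (`NumberField.Embeddings.finite_of_norm_le`).
[cite: Marcus2018, Ch. 5, proof of Theorem 38]; [folklore] -/
theorem finite_units_mul_mem_box {x : 𝓞 K} (hx : x ≠ 0) (T : ℝ) :
    {u : (𝓞 K)ˣ | ∀ w : InfinitePlace K, w ((x : K) * u) ≤ T}.Finite := by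
  classical
  have hx' : (x : K) ≠ 0 := RingOfIntegers.coe_ne_zero_iff.mpr hx
  have hxpos : ∀ w : InfinitePlace K, 0 < w (x : K) := fun w => pos_iff.mpr hx'
  set B : ℝ := |T| * ∑ w : InfinitePlace K, (w (x : K))⁻¹ with hB
  have hsub : ((↑) : (𝓞 K)ˣ → K) '' {u : (𝓞 K)ˣ | ∀ w : InfinitePlace K, w ((x : K) * u) ≤ T} ⊆
      {y : K | IsIntegral ℤ y ∧ ∀ φ : K →+* ℂ, ‖φ y‖ ≤ B} := by
    rintro _ ⟨u, hu, rfl⟩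
    refine ⟨RingOfIntegers.isIntegral_coe _, (le_iff_le _ _).mp (fun w => ?_)⟩
    have h1 : w (u : K) * w (x : K) ≤ |T| := by
      rw [mul_comm, ← map_mul]
      exact (hu w).trans (le_abs_self T)
    have h2 : w (u : K) ≤ |T| * (w (x : K))⁻¹ := by
      rw [← div_eq_mul_inv, le_div_iff₀ (hxpos w)]
      exact h1
    refine h2.trans (mul_le_mul_of_nonneg_left ?_ (abs_nonneg T))
    exact Finset.single_le_sum (f := fun w' : InfinitePlace K => (w' (x : K))⁻¹)
      (fun w' _ => inv_nonneg.2 (apply_nonneg _ _)) (Finset.mem_univ w)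
  exact Set.Finite.of_finite_image ((Embeddings.finite_of_norm_le K ℂ B).subset hsub)
    (Units.coe_injective K).injOn

/-- **Units in a box** (uniformly in the multiplier). There is `C = C(K) ≥ 1` such that for every
nonzero `x ∈ 𝓞_K` and every `T ≥ 1`, any finite set of units `u` with `w(xu) ≤ T` at all infinite
places has at most `C (1 + log T)^{r}` elements, `r = rank K = r₁ + r₂ − 1`. Proof: pick `u₀` in
the set and replace `x` by `xu₀` (now in the box); by `abs_mult_mul_log_le` the map
`u ↦ logEmbedding (u₀⁻¹u)` sends the set into the cube `[−d log T, d log T]^r ∩ unitLattice`, with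
fibres contained in cosets of the (finite) torsion subgroup.
[cite: Marcus2018, Ch. 5, Theorem 38 (proof) and Ch. 6, Lemma 2]; [folklore] -/
theorem card_units_mul_mem_box_le :
    ∃ C : ℝ, 1 ≤ C ∧ ∀ (x : 𝓞 K), x ≠ 0 → ∀ T : ℝ, 1 ≤ T → ∀ s : Finset (𝓞 K)ˣ,
      (∀ u ∈ s, ∀ w : InfinitePlace K, w ((x : K) * u) ≤ T) →
        (s.card : ℝ) ≤ C * (1 + Real.log T) ^ rank K := by
  classical
  obtain ⟨C₁, hC₁1, hC₁⟩ := exists_finset_box_inter_unitLattice K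
  set d : ℕ := Module.finrank ℚ K with hd
  have htfin : (torsion K : Set (𝓞 K)ˣ).Finite :=
    Set.finite_coe_iff.mp (inferInstanceAs (Finite (torsion K)))
  set t : ℕ := htfin.toFinset.card with ht
  have hd1 : (1 : ℝ) ≤ d := by exact_mod_cast Module.finrank_pos (R := ℚ) (M := K)
  have ht1 : (1 : ℝ) ≤ t := by
    have : 1 ≤ t := Finset.card_pos.2 ⟨1, by simp [Set.Finite.mem_toFinset, OneMemClass.one_mem]⟩
    exact_mod_cast this
  refine ⟨t * C₁ * (d : ℝ) ^ rank K, ?_, fun x hx T hT s hs => ?_⟩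
  · have h1 : (1 : ℝ) ≤ (d : ℝ) ^ rank K := one_le_pow₀ hd1
    have h2 : (1 : ℝ) ≤ t * C₁ := by nlinarith
    nlinarith
  have hlogT : 0 ≤ Real.log T := Real.log_nonneg hT
  have hpow0 : (0 : ℝ) ≤ (1 + Real.log T) ^ rank K := by positivity
  rcases s.eq_empty_or_nonempty with rfl | ⟨u₀, hu₀⟩
  · simp only [Finset.card_empty, Nat.cast_zero]
    have : (0 : ℝ) ≤ t * C₁ * (d : ℝ) ^ rank K := by
      have : (0 : ℝ) ≤ C₁ := by linarith
      positivity
    exact mul_nonneg this hpow0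
  have hu₀T := hs u₀ hu₀
  set M : ℝ := d * Real.log T with hM
  have hM0 : 0 ≤ M := mul_nonneg (Nat.cast_nonneg _) hlogT
  obtain ⟨F, hF, hFcard⟩ := hC₁ M hM0
  -- the comparison map into the cube of the unit lattice
  set g : (𝓞 K)ˣ → logSpace K := fun u => logEmbedding K (Additive.ofMul (u₀⁻¹ * u)) with hg
  have hx₀ : (x * u₀ : 𝓞 K) ≠ 0 := mul_ne_zero hx (Units.ne_zero u₀)
  have hx₀T : ∀ w : InfinitePlace K, w ((x * u₀ : 𝓞 K) : K) ≤ T := fun w => by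
    push_cast
    exact hu₀T w
  have hmaps : ∀ u ∈ s, g u ∈ F := by
    intro u hu
    rw [hF]
    refine ⟨Set.mem_univ_pi.2 fun w => ?_, ⟨Additive.ofMul (u₀⁻¹ * u), Submodule.mem_top, rfl⟩⟩
    have hprod : ((x * u₀ : 𝓞 K) : K) * ((u₀⁻¹ * u : (𝓞 K)ˣ) : K) = (x : K) * u := by
      have h1 : (x * u₀ : 𝓞 K) * ((u₀⁻¹ * u : (𝓞 K)ˣ) : 𝓞 K) = x * u := by
        rw [Units.val_mul, mul_assoc, ← mul_assoc (u₀ : 𝓞 K), Units.mul_inv, one_mul]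
      have h2 := congrArg (algebraMap (𝓞 K) K) h1
      simpa only [map_mul] using h2
    have key := abs_mult_mul_log_le K hx₀ hx₀T (u := u₀⁻¹ * u)
      (fun w => by rw [hprod]; exact hs u hu w) w.val
    simp only [hg, logEmbedding_component, Set.mem_Icc]
    exact abs_le.1 key
  -- fibres lie in cosets of the torsion subgroup
  have hfib : ∀ v ∈ F, (s.filter fun u => g u = v).card ≤ t := by
    intro v _
    rcases (s.filter fun u => g u = v).eq_empty_or_nonempty with h | ⟨u₁, hu₁⟩
    · rw [h]
      simp
    rw [Finset.mem_filter] at hu₁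
    refine Finset.card_le_card_of_injOn (fun u => u₁⁻¹ * u) (fun u hu => ?_)
      (fun a _ b _ h => mul_left_cancel h)
    rw [Finset.mem_coe, Finset.mem_filter] at hu
    rw [Finset.mem_coe, Set.Finite.mem_toFinset, SetLike.mem_coe, ← logEmbedding_eq_zero_iff]
    beta_reduce
    have h1 : u₁⁻¹ * u = (u₀⁻¹ * u₁)⁻¹ * (u₀⁻¹ * u) := by group
    rw [h1, ofMul_mul, ofMul_inv, map_add, map_neg]
    change -g u₁ + g u = 0
    rw [hu₁.2, hu.2, neg_add_cancel]
  have hcard : s.card ≤ t * F.card := Finset.card_le_mul_card_image_of_maps_to hmaps t hfib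
  have h1 : (s.card : ℝ) ≤ t * F.card := by exact_mod_cast hcard
  have h2 : (1 + M) ^ rank K ≤ (d : ℝ) ^ rank K * (1 + Real.log T) ^ rank K := by
    rw [← mul_pow]
    refine pow_le_pow_left₀ (by linarith) ?_ _
    rw [hM]
    nlinarith
  have hC₁0 : (0 : ℝ) ≤ C₁ := by linarith
  calc (s.card : ℝ) ≤ t * F.card := h1
    _ ≤ t * (C₁ * (1 + M) ^ rank K) := mul_le_mul_of_nonneg_left hFcard (by linarith)
    _ ≤ t * (C₁ * ((d : ℝ) ^ rank K * (1 + Real.log T) ^ rank K)) :=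
        mul_le_mul_of_nonneg_left (mul_le_mul_of_nonneg_left h2 hC₁0) (by linarith)
    _ = t * C₁ * (d : ℝ) ^ rank K * (1 + Real.log T) ^ rank K := by ring

/-- `Set.ncard` form of `card_units_mul_mem_box_le`: `#{u ∈ 𝓞_Kˣ : w(xu) ≤ T ∀ w} ≤ C (1 + log T)^r`
for all nonzero `x ∈ 𝓞_K` and `T ≥ 1`. [cite: Marcus2018, Ch. 5, Theorem 38 (proof) and Ch. 6, Lemma 2];
[folklore] -/
theorem ncard_units_mul_mem_box_le :
    ∃ C : ℝ, 1 ≤ C ∧ ∀ (x : 𝓞 K), x ≠ 0 → ∀ T : ℝ, 1 ≤ T →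
      (({u : (𝓞 K)ˣ | ∀ w : InfinitePlace K, w ((x : K) * u) ≤ T}).ncard : ℝ) ≤
        C * (1 + Real.log T) ^ rank K := by
  obtain ⟨C, hC1, hC⟩ := card_units_mul_mem_box_le K
  refine ⟨C, hC1, fun x hx T hT => ?_⟩
  have hfin := finite_units_mul_mem_box K hx T
  rw [Set.ncard_eq_toFinset_card _ hfin]
  exact hC x hx T hT _ fun u hu => (Set.Finite.mem_toFinset hfin).1 hu

/-- **Generators of a fixed ideal in a box.** There is `C = C(K) ≥ 1` such that for every ideal
`I` of `𝓞_K` and every `T ≥ 1`, any finite set of generators `y` of `I` (`(y) = I`) with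
`w(y) ≤ T` at all infinite places has at most `C (1 + log T)^{rank K}` elements (two generators
differ by a unit; apply `card_units_mul_mem_box_le`). This is the count behind "the element
`α + h_m` will lie in a residue class coprime to the modulus iff `𝔡_m = 𝔢_m = 1` … the only case
that yields a contribution" in the number-field Maynard–Tao sieve (Castillo et al., proof of
Lemma 2.3): primes of `𝓞_K` in a box generating a fixed prime ideal are `≪ (log T)^{r}`.
[cite: Marcus2018, Ch. 5, Theorem 38 (proof) and Ch. 6, Lemma 2]; [folklore] -/
theorem card_generators_mem_box_le :
    ∃ C : ℝ, 1 ≤ C ∧ ∀ (I : Ideal (𝓞 K)) (T : ℝ), 1 ≤ T → ∀ s : Finset (𝓞 K),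
      (∀ y ∈ s, Ideal.span {y} = I ∧ ∀ w : InfinitePlace K, w (y : K) ≤ T) →
        (s.card : ℝ) ≤ C * (1 + Real.log T) ^ rank K := by
  classical
  obtain ⟨C, hC1, hC⟩ := card_units_mul_mem_box_le K
  refine ⟨C, hC1, fun I T hT s hs => ?_⟩
  have hpow : (1 : ℝ) ≤ (1 + Real.log T) ^ rank K :=
    one_le_pow₀ (by linarith [Real.log_nonneg hT])
  rcases s.eq_empty_or_nonempty with rfl | ⟨y₀, hy₀⟩
  · simp only [Finset.card_empty, Nat.cast_zero]
    nlinarith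
  by_cases hy₀0 : y₀ = 0
  · -- `I = ⊥`: the only generator is `0`
    have hsub : s ⊆ {0} := fun y hy => by
      have h1 : Ideal.span ({y} : Set (𝓞 K)) = Ideal.span {y₀} := (hs y hy).1.trans (hs y₀ hy₀).1.symm
      rw [hy₀0, Ideal.span_singleton_eq_bot.2 rfl, Ideal.span_singleton_eq_bot] at h1
      simp [h1]
    have h : (s.card : ℝ) ≤ 1 := by exact_mod_cast (Finset.card_le_card hsub).trans (by simp)
    nlinarith
  · have hassoc : ∀ y ∈ s, ∃ u : (𝓞 K)ˣ, y₀ * u = y := fun y hy =>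
      Ideal.span_singleton_eq_span_singleton.1 ((hs y₀ hy₀).1.trans (hs y hy).1.symm)
    choose! u hu using hassoc
    have hinj : Set.InjOn u s := fun a ha b hb h => by rw [← hu a ha, ← hu b hb, h]
    rw [← Finset.card_image_of_injOn hinj]
    refine hC y₀ hy₀0 T hT _ fun v hv => ?_
    obtain ⟨y, hy, rfl⟩ := Finset.mem_image.1 hv
    intro w
    have h1 : (y₀ : K) * ((u y : (𝓞 K)ˣ) : K) = ((y₀ * (u y : (𝓞 K)ˣ) : 𝓞 K) : K) := by
      push_cast
      rfl
    rw [hu y hy] at h1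
    rw [h1]
    exact (hs y hy).2 w

end Literature.NumberTheory.NumberFields
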